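import Literature.NumberTheory.EllipticCurves.CyclotomicLineCocycleCountProofs
import HarnessLib

/-!
# Counting cocycles of an OPEN SUBGROUP `H ≤ Γ_{K_v}` with values in a cyclotomic line:
# `#H¹(H, C[p^k]) ≤ B · M₀` from a twisted Kummer count over the layer `K̄_v^{N' ∩ H}`

`Proofs` file (theorems only: **no definition, no named fact, nothing asserted**) in topic
`NumberTheory/EllipticCurves`, the subgroup twin of `CyclotomicLineCocycleCountProofs` (R. Greenberg,
*Iwasawa theory for elliptic curves*, LNM 1716 (1999), §2 Prop. 2.2, p. 73: "`H¹(M, C)` has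
`ℤ_p`-corank `[M : ℚ_p]`"; §3 Lemma 3.4, p. 89). The parent file counts the continuous cocycles of
the WHOLE local Galois group `Γ = Γ_{K_v}` with values in a cyclotomic line `ℤ P₀` (the
cohomological half of input (C1) of the elementary proof of Greenberg's Lemma 3.4 at the layer
`n = 0`). At a layer `n ≥ 1` of a `ℤ_p`-tower the relevant group is an OPEN SUBGROUP
`H = H_{v,n} = Gal(K̄_v/(K_n)_v)` containing an arithmetic Frobenius `Fr` (the layers are totally
ramified at `v`). **This file re-proves the count for such an `H`**, with the arithmetic input — the
twisted Kummer count over the fixed field `L = K̄_v^{N' ∩ H}` of `N' ∩ H`, `N' = Gal(K̄_v/K_v(ζ_L))` —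
taken as a HYPOTHESIS (`hR`), so that the cohomology is decoupled from the valuation theory of the
(ramified) layer `L`:

* `exists_kummer_generator_subgroup` — the Kummer element of a cocycle `ψ : H → ℤ P₀`: Hilbert 90
  for the normal extension `K̄_v/L` (`AlgEquiv.exists_smul_div_eq_of_isOpen`) applied to `ζ^{a(·)}`
  on `Aut_L(K̄_v) ⊆ N' ∩ H` (`hL2`), `α = x^{p^k} ∈ L` (`hL3`), and the twist
  `Fr(α) α^{-e} ∈ (L^×)^{p^k}`.
* `exists_sub_eq_coboundary_of_kummer_subgroup` — cocycles with Kummer-equivalent generators differ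
  on `N' ∩ H` by the coboundary of a multiple of `P₀`.
* `exists_finset_cocycle_reps_of_cyclotomicLine_subgroup` — **the count**: if the classes
  `α (L^×)^{p^k}` with `Fr(α) α^{-e} ∈ (L^×)^{p^k}` have `≤ B` representatives (`hR`), the continuous
  cocycles `H → ℤ P₀` fall into at most `B · M₀` classes modulo coboundaries of `p^k`-torsion
  elements, `M₀ = #{0 ≤ c < p^k : c P₀ is H-fixed}`. The group theory: `H` is topologically
  generated by `N' ∩ H` and `Fr` (every `σ ∈ Γ` is `Fr^m τ u` with `τ` inertial — which fixes `ζ_L` —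
  and `u` in any open subgroup, `exists_eq_frobenius_pow_mul_inertia_mul`; for `σ ∈ H` and `u ∈ H`
  also `τ ∈ H`).

The field `L` enters only through three hypotheses: (`hL1`) every `σ ∈ H` fixing `ζ_L` fixes `L`
pointwise; (`hL2`) every `L`-automorphism of `K̄_v` lies in `H` and fixes `ζ_L`; (`hL3`) an element
fixed by every `σ ∈ H` with `σ ζ_L = ζ_L` lies in `L` — i.e. `L = K̄_v^{N' ∩ H}` by infinite Galois
theory, instantiated in the sequel (`LocalLayerTwistedKummerCountProofs`).

HONEST FRAMING (cell `bsd-f1-sign2`, WIDTH-5 attach seat `bsd-line-att-p5` g42 on crux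
stmt-BirchSwinnertonDyer-22298, lineage successor of g41): step (4) of the route to the layer
Kummer count (C1ₙ) (memo `Cruxes/MainConjectureOfRankZeroBSDAtTwo/LEMMA34-LAYERS-att-p5-g41.md` §6);
pure group cohomology bookkeeping; closes no item; BSD is not proved by any of this.

## References

* [GreenbergLNM1716] R. Greenberg, *Iwasawa theory for elliptic curves*, LNM 1716 (1999), §2
  Prop. 2.2 (p. 73), §3 Lemma 3.4 (p. 89).
* [SerreLocalFields1979] J.-P. Serre, *Local Fields* (1979), X §1 Prop. 2 (Hilbert 90), X §3
  (Kummer theory), XIV §4.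
* J.-P. Serre, *Galois Cohomology* (1997), I.§2.6, I.§5.1.

## Design

No definitions; `noncomputable section`; one universe `u`; the cocycles are Mathlib's continuous
cocycles of the subgroup `↥H` (subspace topology) acting on the discrete module `A` by restriction
(`discreteTopRep ↥H A`, `(g : ↥H) • y = (g : Γ) • y`). Axioms: `propext`, `Classical.choice`,
`Quot.sound`.
-/

noncomputable section

open scoped Classical NNReal
open NumberField IsDedekindDomain

universe u

namespace IsDedekindDomain.HeightOneSpectrum

open Literature.NumberTheory.EllipticCurves Literature.NumberTheory.GaloisRepresentations Field
  Literature.NumberTheory.EllipticCurves.TwistedKummer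
  Literature.NumberTheory.EllipticCurves.ResKernel
  Literature.NumberTheory.GaloisRepresentations.LocalWeilDatum

variable {K : Type u} [Field K] [NumberField K] {v : HeightOneSpectrum (𝓞 K)}

/-! ## §1 The Kummer element of a cocycle of `H` with values in the cyclotomic line -/

section Kummer

variable {p : ℕ} [hp : Fact p.Prime]
  (H : Subgroup (absoluteGaloisGroup (v.adicCompletion K)))
  {Fr : absoluteGaloisGroup (v.adicCompletion K)} (hFrH : Fr ∈ H)
  {ζL : AlgebraicClosure (v.adicCompletion K)}
  (hFrL : ∃ t : ℕ, Fr • ζL = ζL ^ t)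
  (L : IntermediateField (v.adicCompletion K) (AlgebraicClosure (v.adicCompletion K)))
  (hL1 : ∀ σ ∈ H, σ • ζL = ζL → ∀ y ∈ L, σ • y = y)
  (hL2 : ∀ τ : AlgebraicClosure (v.adicCompletion K) ≃ₐ[L] AlgebraicClosure (v.adicCompletion K),
    toAbsGalHom L τ ∈ H ∧ toAbsGalHom L τ • ζL = ζL)
  (hL3 : ∀ y : AlgebraicClosure (v.adicCompletion K), (∀ σ ∈ H, σ • ζL = ζL → σ • y = y) → y ∈ L)
  {A : Type u} [AddCommGroup A] [DistribMulAction (absoluteGaloisGroup (v.adicCompletion K)) A]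
  [TopologicalSpace A] [DiscreteTopology A]
  {k : ℕ} {P₀ : A} (hP₀ : ∀ m : ℤ, m • P₀ = 0 ↔ ((p ^ k : ℕ) : ℤ) ∣ m)
  {ζ : AlgebraicClosure (v.adicCompletion K)} (hζ : IsPrimitiveRoot ζ (p ^ k))
  (hN' : ∀ σ : absoluteGaloisGroup (v.adicCompletion K), σ • ζL = ζL →
    ∃ c : ℕ, σ • P₀ = c • P₀ ∧ σ • ζ = ζ ^ c)
  {a b : ℕ} (ha : Fr • ζ = ζ ^ a) (hb : Fr • P₀ = b • P₀) {e : ℕ}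
  (he : ((p ^ k : ℕ) : ℤ) ∣ (e * b : ℕ) - a)

include hFrH hFrL hL1 hL2 hL3 hP₀ hζ hN' ha hb he in
/-- **The Kummer element of a cocycle `ψ : H → ℤ P₀` of an open subgroup `H ∋ Fr`.** Let
`L = K̄_v^{N' ∩ H}` (hypotheses `hL1`–`hL3`), `P₀` of order `p^k`, `ζ` a primitive `p^k`-th root of
unity on which every `σ` fixing `ζ_L` acts by the same exponent as on `P₀`, `Fr ζ = ζ^a`,
`Fr P₀ = b P₀`, `e b ≡ a (mod p^k)`. For a continuous cocycle `ψ = a(·) P₀` of `H` there is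
`x ∈ K̄_v^×` with `n x = ζ^{a(n)} x` for every `n ∈ H` fixing `ζ_L` (Hilbert 90 for the normal
extension `K̄_v/L` applied to the locally constant cocycle `ζ^{a(·)}` on `Aut_L(K̄_v) ⊆ N' ∩ H`:
Serre, *Local Fields*, X §1 Prop. 2 / `AlgEquiv.exists_smul_div_eq_of_isOpen`), so that
`α = x^{p^k} ∈ L`; and the cocycle identity between `Fr` and `N' ∩ H` (note `Fr⁻¹ n Fr ∈ H`) shows
`Fr(α) α^{-e} = γ^{p^k}` with `γ = Fr(x) x^{-e} ζ^{-e a(Fr)} ∈ L^×`.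
[cite: SerreLocalFields1979, Ch. X §1 Prop. 2 and §3] -/
theorem exists_kummer_generator_subgroup
    (ψ : contOneCocycles (discreteTopRep H A))
    (hψ : ∀ g, ∃ c : ℕ, ψ.1 g = c • P₀) :
    ∃ x : AlgebraicClosure (v.adicCompletion K), x ≠ 0 ∧
      (∀ n : H, (n : absoluteGaloisGroup (v.adicCompletion K)) • ζL = ζL →
        ∃ c : ℕ, ψ.1 n = c • P₀ ∧ (n : absoluteGaloisGroup (v.adicCompletion K)) • x = ζ ^ c * x) ∧
      x ^ p ^ k ∈ L ∧
      ∃ γ ∈ L, γ ≠ 0 ∧ Fr • (x ^ p ^ k) * ((x ^ p ^ k) ^ e)⁻¹ = γ ^ p ^ k := by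
  -- notation and basic facts
  have hpk : p ^ k ≠ 0 := pow_ne_zero k hp.out.ne_zero
  have hζ0 : ζ ≠ 0 := hζ.ne_zero hpk
  haveI : Normal L (AlgebraicClosure (v.adicCompletion K)) :=
    normal_algebraicClosure_intermediateField L
  have hsmulH : ∀ (g : H) (y : A), g • y = (g : absoluteGaloisGroup (v.adicCompletion K)) • y :=
    fun _ _ ↦ rfl
  -- exponents
  choose aψ haψ using hψ
  choose cN hcNP hcNζ using hN'
  have hexp : ∀ {m m' : ℤ}, m • P₀ = m' • P₀ ↔ ζ ^ m = ζ ^ m' := fun {m m'} ↦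
    zsmul_eq_zsmul_iff_zpow_eq_zpow hP₀ hζ hpk m m'
  have hexpn : ∀ {c c' : ℕ}, c • P₀ = c' • P₀ ↔ ζ ^ c = ζ ^ c' := fun {c c'} ↦
    nsmul_eq_nsmul_iff_pow_eq_pow hP₀ hζ hpk c c'
  -- the automorphisms of `K̄_v/L` inside `H`
  let g : (AlgebraicClosure (v.adicCompletion K) ≃ₐ[L] AlgebraicClosure (v.adicCompletion K)) → H :=
    fun τ ↦ ⟨toAbsGalHom L τ, (hL2 τ).1⟩
  have hg : ∀ τ y, (g τ : absoluteGaloisGroup (v.adicCompletion K)) • y = τ y :=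
    fun τ y ↦ toAbsGalHom_smul L τ y
  have hgL : ∀ τ, (g τ : absoluteGaloisGroup (v.adicCompletion K)) • ζL = ζL := fun τ ↦ (hL2 τ).2
  have hgmul : ∀ τ τ', g (τ * τ') = g τ * g τ' := fun τ τ' ↦
    Subtype.ext (map_mul (toAbsGalHom L) τ τ')
  have hgcont : Continuous g :=
    (continuous_subtype_val.comp (continuous_galFixingOfAlgEquiv L)).subtype_mk _
  -- the multiplicative cocycle `f τ = ζ^{a(g τ)}`
  set ζu : (AlgebraicClosure (v.adicCompletion K))ˣ := Units.mk0 ζ hζ0 with hζu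
  let f : (AlgebraicClosure (v.adicCompletion K) ≃ₐ[L] AlgebraicClosure (v.adicCompletion K)) →
      (AlgebraicClosure (v.adicCompletion K))ˣ := fun τ ↦ ζu ^ aψ (g τ)
  have hfval : ∀ τ, ((f τ : (AlgebraicClosure (v.adicCompletion K))ˣ) :
      AlgebraicClosure (v.adicCompletion K)) = ζ ^ aψ (g τ) := fun τ ↦ by
    simp [f, hζu]
  have hsmul_val : ∀ (τ : AlgebraicClosure (v.adicCompletion K) ≃ₐ[L]
      AlgebraicClosure (v.adicCompletion K)) (u : (AlgebraicClosure (v.adicCompletion K))ˣ),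
      ((τ • u : (AlgebraicClosure (v.adicCompletion K))ˣ) : AlgebraicClosure (v.adicCompletion K)) =
        τ (u : AlgebraicClosure (v.adicCompletion K)) := fun τ u ↦ rfl
  have hf : ∀ τ τ', f (τ * τ') = τ • f τ' * f τ := by
    intro τ τ'
    apply Units.ext
    rw [Units.val_mul, hsmul_val, hfval, hfval, hfval, map_pow, ← hg, hcNζ _ (hgL τ), ← pow_mul,
      ← pow_add, hgmul]
    -- exponents: `a(g g') ≡ c a(g') + a(g)`
    rw [← hexpn, add_smul, mul_smul, smul_comm (cN _ _) (aψ (g τ')) P₀, ← hcNP _ (hgL τ),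
      ← hsmulH, smul_comm (aψ (g τ')) (g τ) P₀, ← haψ, ← haψ, ← haψ, ψ.2 (g τ) (g τ'), add_comm]
    rfl
  have hopen : IsOpen {τ | f τ = 1} := by
    have heq : {τ | f τ = 1} = {τ | ψ.1 (g τ) = 0} := by
      ext τ
      simp only [Set.mem_setOf_eq]
      rw [← Units.val_eq_one, hfval, haψ (g τ), ← pow_zero ζ, ← hexpn, zero_smul]
    rw [heq]
    have hc : Continuous fun τ ↦ ψ.1 (g τ) := ψ.1.continuous.comp hgcont
    exact (isOpen_discrete ({0} : Set A)).preimage hc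
  obtain ⟨xu, hxu⟩ := AlgEquiv.exists_smul_div_eq_of_isOpen f hf hopen
  set x : AlgebraicClosure (v.adicCompletion K) := (xu : AlgebraicClosure (v.adicCompletion K))
    with hxdef
  have hx0 : x ≠ 0 := xu.ne_zero
  -- `n x = ζ^{a(n)} x` on `N' ∩ H`
  have hτx : ∀ τ, τ x = ζ ^ aψ (g τ) * x := fun τ ↦ by
    have h := congrArg (fun u : (AlgebraicClosure (v.adicCompletion K))ˣ ↦
      (u : AlgebraicClosure (v.adicCompletion K))) (hxu τ)
    simp only [Units.val_div_eq_div_val, hsmul_val, hfval] at h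
    rw [div_eq_iff hx0] at h
    exact h
  have hkum : ∀ n : H, (n : absoluteGaloisGroup (v.adicCompletion K)) • ζL = ζL →
      ∃ c : ℕ, ψ.1 n = c • P₀ ∧ (n : absoluteGaloisGroup (v.adicCompletion K)) • x = ζ ^ c * x := by
    intro n hn
    obtain ⟨τ, hτ⟩ := galFixingOfAlgEquiv_surjective L
      ⟨(n : absoluteGaloisGroup (v.adicCompletion K)), (mem_galFixing_iff _).mpr (hL1 n n.2 hn)⟩
    have hgn' : (toAbsGalHom L τ : absoluteGaloisGroup (v.adicCompletion K)) = n :=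
      congrArg Subtype.val hτ
    have hgn : g τ = n := Subtype.ext hgn'
    refine ⟨aψ n, haψ n, ?_⟩
    rw [← hgn, hg, hτx]
  -- `α = x^{p^k} ∈ L`
  have hαfix : ∀ σ ∈ H, σ • ζL = ζL → σ • x ^ p ^ k = x ^ p ^ k := by
    intro σ hσH hσ
    obtain ⟨c, -, hc⟩ := hkum ⟨σ, hσH⟩ hσ
    change σ • x = ζ ^ c * x at hc
    rw [smul_pow', hc, mul_pow, pow_right_comm, hζ.pow_eq_one, one_pow, one_mul]
  have hαL : x ^ p ^ k ∈ L := hL3 _ hαfix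
  refine ⟨x, hx0, hkum, hαL, ?_⟩
  -- the twist: `γ = Fr(x) x^{-e} ζ^{-e a(Fr)}`
  obtain ⟨t, ht⟩ := hFrL
  have hmodeq : ∀ {m m' : ℕ}, ζ ^ m = ζ ^ m' ↔ ((p ^ k : ℕ) : ℤ) ∣ (m : ℤ) - m' := fun {m m'} ↦ by
    rw [← hexpn, ← sub_eq_zero, ← natCast_zsmul, ← natCast_zsmul, ← sub_smul, hP₀]
  set FrH : H := ⟨Fr, hFrH⟩ with hFrHdef
  set y : AlgebraicClosure (v.adicCompletion K) := Fr • x with hydef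
  set γ : AlgebraicClosure (v.adicCompletion K) := y * (x ^ e)⁻¹ * (ζ ^ (e * aψ FrH))⁻¹ with hγdef
  have hy0 : y ≠ 0 := by rw [hydef]; exact (smul_ne_zero_iff_ne Fr).mpr hx0
  have hγfix : ∀ n ∈ H, n • ζL = ζL → n • γ = γ := by
    intro n hnH hn
    -- `n' = Fr⁻¹ n Fr ∈ H` also fixes `ζ_L`
    set n' : absoluteGaloisGroup (v.adicCompletion K) := Fr⁻¹ * n * Fr with hn'def
    have hn'H : n' ∈ H := H.mul_mem (H.mul_mem (H.inv_mem hFrH) hnH) hFrH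
    have hn' : n' • ζL = ζL := by
      rw [hn'def, mul_smul, mul_smul, ht, smul_pow', hn, ← ht, inv_smul_smul]
    obtain ⟨c, hψn, hnx⟩ := hkum ⟨n, hnH⟩ hn
    obtain ⟨c', hψn', hn'x⟩ := hkum ⟨n', hn'H⟩ hn'
    change n • x = ζ ^ c * x at hnx
    change n' • x = ζ ^ c' * x at hn'x
    have hnP := hcNP n hn
    have hnζ := hcNζ n hn
    set cn : ℕ := cN n hn with hcndef
    -- the cocycle identity between `Fr` and `n'`: `a_F + c' b ≡ c + a_F c_n`
    have hcomm : FrH * ⟨n', hn'H⟩ = ⟨n, hnH⟩ * FrH := by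
      apply Subtype.ext
      change Fr * n' = n * Fr
      rw [hn'def]; group
    have hcoc : (aψ FrH + c' * b) • P₀ = (c + aψ FrH * cn) • P₀ := by
      have h1 := ψ.2 FrH ⟨n', hn'H⟩
      have h2 := ψ.2 ⟨n, hnH⟩ FrH
      rw [hcomm] at h1
      have h12 := h1.symm.trans h2
      change ψ.1 FrH + Fr • ψ.1 ⟨n', hn'H⟩ = ψ.1 ⟨n, hnH⟩ + n • ψ.1 FrH at h12
      rw [hψn', hψn, haψ FrH, smul_comm Fr c' P₀, hb, smul_comm n (aψ FrH) P₀, hnP,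
        ← mul_smul, ← mul_smul, ← add_smul, ← add_smul] at h12
      exact h12
    have hd1 : ((p ^ k : ℕ) : ℤ) ∣ ((aψ FrH + c' * b : ℕ) : ℤ) - ((c + aψ FrH * cn : ℕ) : ℤ) :=
      hmodeq.mp (hexpn.mp hcoc)
    -- the exponent identity for `γ`
    have hkey : ζ ^ (a * c' + e * aψ FrH) = ζ ^ (c * e + cn * (e * aψ FrH)) := by
      rw [hmodeq]
      have e1 : ((a * c' + e * aψ FrH : ℕ) : ℤ) - ((c * e + cn * (e * aψ FrH) : ℕ) : ℤ) =
          (e : ℤ) * (((aψ FrH + c' * b : ℕ) : ℤ) - ((c + aψ FrH * cn : ℕ) : ℤ)) -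
            (c' : ℤ) * (((e * b : ℕ) : ℤ) - (a : ℤ)) := by
        push_cast; ring
      rw [e1]
      exact dvd_sub (hd1.mul_left _) (he.mul_left _)
    -- compute `n • γ`
    have hny : n • y = ζ ^ (a * c') * y := by
      rw [hydef, ← mul_smul, show n * Fr = Fr * n' by rw [hn'def]; group, mul_smul, hn'x, smul_mul',
        smul_pow', ha, ← pow_mul]
    rw [hγdef, smul_mul', smul_mul', smul_inv'', smul_inv'', smul_pow', smul_pow', hny, hnx, hnζ,
      mul_pow, ← pow_mul, ← pow_mul]
    have hζc : ζ ^ (cn * (e * aψ FrH)) ≠ 0 := pow_ne_zero _ hζ0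
    have hζe : ζ ^ (c * e) ≠ 0 := pow_ne_zero _ hζ0
    have hζa : ζ ^ (e * aψ FrH) ≠ 0 := pow_ne_zero _ hζ0
    have hxe : x ^ e ≠ 0 := pow_ne_zero _ hx0
    field_simp
    linear_combination hkey
  have hγL : γ ∈ L := hL3 _ hγfix
  have hγ0 : γ ≠ 0 := mul_ne_zero (mul_ne_zero hy0 (inv_ne_zero (pow_ne_zero _ hx0)))
    (inv_ne_zero (pow_ne_zero _ hζ0))
  refine ⟨γ, hγL, hγ0, ?_⟩
  rw [hγdef, mul_pow, mul_pow, inv_pow, inv_pow, pow_right_comm ζ (e * aψ FrH) (p ^ k),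
    hζ.pow_eq_one, one_pow, inv_one, mul_one, pow_right_comm x e (p ^ k), hydef, ← smul_pow']

include hL1 hP₀ hζ hN' in
/-- **Cocycles of `H` with Kummer-equivalent generators differ on `N' ∩ H` by the coboundary of a
multiple of `P₀`.** If `x, x'` are Kummer generators of `ψ, ψ'` (`n x = ζ^{a(n)} x` for `n ∈ H`
fixing `ζ_L`) with `x^{p^k} = r β^{p^k}`, `x'^{p^k} = r β'^{p^k}` for the same `r` and `β, β' ∈ L^×`,
then `x β' / (x' β) = ζ^s` and `ψ(n) - ψ'(n) = n(s P₀) - s P₀` for all `n ∈ H` fixing `ζ_L`. Serre,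
*Local Fields*, X §3 (injectivity of `L^×/(L^×)^m → H¹(L, μ_m)`).
[cite: SerreLocalFields1979, Ch. X §3] -/
theorem exists_sub_eq_coboundary_of_kummer_subgroup
    (ψ ψ' : contOneCocycles (discreteTopRep H A))
    {x x' β β' r : AlgebraicClosure (v.adicCompletion K)} (hx0 : x ≠ 0) (hx'0 : x' ≠ 0)
    (hβL : β ∈ L) (hβ0 : β ≠ 0) (hβ'L : β' ∈ L) (hβ'0 : β' ≠ 0)
    (hr : x ^ p ^ k = r * β ^ p ^ k) (hr' : x' ^ p ^ k = r * β' ^ p ^ k)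
    (hx : ∀ n : H, (n : absoluteGaloisGroup (v.adicCompletion K)) • ζL = ζL →
      ∃ c : ℕ, ψ.1 n = c • P₀ ∧ (n : absoluteGaloisGroup (v.adicCompletion K)) • x = ζ ^ c * x)
    (hx' : ∀ n : H, (n : absoluteGaloisGroup (v.adicCompletion K)) • ζL = ζL →
      ∃ c : ℕ, ψ'.1 n = c • P₀ ∧ (n : absoluteGaloisGroup (v.adicCompletion K)) • x' = ζ ^ c * x') :
    ∃ s : ℕ, ∀ n : H, (n : absoluteGaloisGroup (v.adicCompletion K)) • ζL = ζL →
      ψ.1 n - ψ'.1 n = n • (s • P₀) - s • P₀ := by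
  have hpk : p ^ k ≠ 0 := pow_ne_zero k hp.out.ne_zero
  have hζ0 : ζ ≠ 0 := hζ.ne_zero hpk
  have hsmulH : ∀ (g : H) (y : A), g • y = (g : absoluteGaloisGroup (v.adicCompletion K)) • y :=
    fun _ _ ↦ rfl
  have hr0 : r ≠ 0 := by
    rintro rfl; rw [zero_mul] at hr; exact pow_ne_zero _ hx0 hr
  -- `ω = x β' / (x' β)` is a `p^k`-th root of unity
  set ω : AlgebraicClosure (v.adicCompletion K) := x * β' * (x' * β)⁻¹ with hωdef
  have hωpow : ω ^ p ^ k = 1 := by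
    rw [hωdef, mul_pow, mul_pow, inv_pow, mul_pow, hr, hr']
    field_simp
  obtain ⟨s, -, hs⟩ := hζ.eq_pow_of_pow_eq_one hωpow
  refine ⟨s, fun n hn ↦ ?_⟩
  obtain ⟨c, hψn, hnx⟩ := hx n hn
  obtain ⟨c', hψ'n, hnx'⟩ := hx' n hn
  obtain ⟨cn, hnP, hnζ⟩ := hN' n hn
  -- `n ω = ζ^c (ζ^{c'})⁻¹ ω = ζ^{c_n s}`
  have hnω : (n : absoluteGaloisGroup (v.adicCompletion K)) • ω = ζ ^ c * (ζ ^ c')⁻¹ * ω := by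
    rw [hωdef, smul_mul', smul_mul', smul_inv'', smul_mul', hnx, hnx', hL1 n n.2 hn β hβL,
      hL1 n n.2 hn β' hβ'L]
    field_simp
  have hnω' : (n : absoluteGaloisGroup (v.adicCompletion K)) • ω = ζ ^ (cn * s) := by
    rw [← hs, smul_pow', hnζ, ← pow_mul]
  have hkey : ζ ^ (c + s) = ζ ^ (c' + cn * s) := by
    have hω0 : ω ≠ 0 := by rw [← hs]; exact pow_ne_zero _ hζ0
    have h := hnω.symm.trans hnω'
    rw [← hs] at h
    have hζc' : ζ ^ c' ≠ 0 := pow_ne_zero _ hζ0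
    field_simp at h
    rw [pow_add, pow_add]
    linear_combination h
  have hP : (c + s) • P₀ = (c' + cn * s) • P₀ :=
    (nsmul_eq_nsmul_iff_pow_eq_pow hP₀ hζ hpk _ _).mpr hkey
  rw [hψn, hψ'n, hsmulH, smul_comm (n : absoluteGaloisGroup (v.adicCompletion K)) s P₀, hnP,
    ← mul_smul, sub_eq_sub_iff_add_eq_add, ← add_smul, ← add_smul,
    show s * cn + c' = c' + cn * s by ring]
  exact hP

end Kummer

/-! ## §2 Counting the cocycles `H → ℤ P₀` modulo coboundaries -/

section Count

variable {w : Valuation (AlgebraicClosure (v.adicCompletion K)) ℝ≥0}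
  (hw : ∀ x, (w x : ℝ) = spectralNorm (v.adicCompletion K) (AlgebraicClosure (v.adicCompletion K)) x)
  {𝔐 : Ideal v.localAbsIntegers} (h𝔐 : 𝔐 ∈ v.localPrimesAbove)
  {p : ℕ} [hp : Fact p.Prime]
  {Fr : absoluteGaloisGroup (v.adicCompletion K)}
  (hFr : IsArithFrobAt (v.adicCompletionIntegers K) Fr 𝔐)
  (H : Subgroup (absoluteGaloisGroup (v.adicCompletion K)))
  (hHopen : IsOpen (H : Set (absoluteGaloisGroup (v.adicCompletion K)))) (hFrH : Fr ∈ H)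
  {f : ℕ} (hf : f ≠ 0) {ζL : AlgebraicClosure (v.adicCompletion K)}
  (hζL : IsPrimitiveRoot ζL (Nat.card (IsLocalRing.ResidueField (v.adicCompletionIntegers K)) ^ f - 1))
  (L : IntermediateField (v.adicCompletion K) (AlgebraicClosure (v.adicCompletion K)))
  (hL1 : ∀ σ ∈ H, σ • ζL = ζL → ∀ y ∈ L, σ • y = y)
  (hL2 : ∀ τ : AlgebraicClosure (v.adicCompletion K) ≃ₐ[L] AlgebraicClosure (v.adicCompletion K),
    toAbsGalHom L τ ∈ H ∧ toAbsGalHom L τ • ζL = ζL)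
  (hL3 : ∀ y : AlgebraicClosure (v.adicCompletion K), (∀ σ ∈ H, σ • ζL = ζL → σ • y = y) → y ∈ L)
  {A : Type u} [AddCommGroup A] [DistribMulAction (absoluteGaloisGroup (v.adicCompletion K)) A]
  [TopologicalSpace A] [DiscreteTopology A]
  (hcont : ∀ y : A, Continuous fun g : absoluteGaloisGroup (v.adicCompletion K) ↦ g • y)
  {k : ℕ} {P₀ : A} (hP₀ : ∀ m : ℤ, m • P₀ = 0 ↔ ((p ^ k : ℕ) : ℤ) ∣ m)
  {ζ : AlgebraicClosure (v.adicCompletion K)} (hζ : IsPrimitiveRoot ζ (p ^ k))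
  (hN' : ∀ σ : absoluteGaloisGroup (v.adicCompletion K), σ • ζL = ζL →
    ∃ c : ℕ, σ • P₀ = c • P₀ ∧ σ • ζ = ζ ^ c)
  {a b : ℕ} (ha : Fr • ζ = ζ ^ a) (hb : Fr • P₀ = b • P₀) {e : ℕ}
  (he : ((p ^ k : ℕ) : ℤ) ∣ (e * b : ℕ) - a)
  {B : ℕ}
  (hR : ∃ R : Finset (AlgebraicClosure (v.adicCompletion K)), R.card ≤ B ∧
    (∀ r ∈ R, r ∈ L ∧ r ≠ 0) ∧
    ∀ α : AlgebraicClosure (v.adicCompletion K), α ∈ L → α ≠ 0 →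
      (∃ β ∈ L, β ≠ 0 ∧ Fr • α * (α ^ e)⁻¹ = β ^ p ^ k) →
        ∃ r ∈ R, ∃ β ∈ L, β ≠ 0 ∧ α = r * β ^ p ^ k)

set_option maxHeartbeats 1600000 in
include hw h𝔐 hFr hHopen hFrH hf hζL hL1 hL2 hL3 hcont hP₀ hζ hN' ha hb he hR in
/-- **Counting cocycles of an open subgroup `H ∋ Fr` with values in a cyclotomic line.** With the
notation of the module docstring: if the classes of `α ∈ L^×` modulo `(L^×)^{p^k}` with
`Fr(α) α^{-e} ∈ (L^×)^{p^k}` have at most `B` representatives (`hR`, the twisted Kummer count over the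
layer `L = K̄_v^{N' ∩ H}`), then the continuous cocycles `ψ : H → ℤ P₀` fall into at most `B · M₀`
classes modulo coboundaries `∂t` of `p^k`-torsion elements `t`, `M₀ = #{0 ≤ c < p^k : c P₀ is H-fixed}`
— hypothesis (C1ₙ) of the Kummer skeleton for the line `C[p^k] = ℤ P₀` on the group `H = H_{v,n}`.
This is the bound behind Greenberg's "`H¹(M_η, C)` has `ℤ_p`-corank `[M_η : ℚ_p]`" (LNM 1716, §2
Prop. 2.2, p. 73) for the completed layer `M_η = (K_n)_v`, obtained from Hilbert 90 and a count of
Kummer classes instead of Tate's Euler characteristic formula. Two cocycles with the same Kummer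
representative differ on `N' ∩ H` by `∂(s P₀)`; the difference of two cocycles vanishing on `N' ∩ H`
is determined by its value at `Fr` (`N' ∩ H` and `Fr` generate `H` topologically:
`exists_eq_frobenius_pow_mul_inertia_mul`, inertia fixing `ζ_L`) modulo `(Fr - 1)` of the
`N' ∩ H`-fixed multiples of `P₀`, whose cokernel has `≤ M₀` elements.
[cite: GreenbergLNM1716, §2 Prop. 2.2 (proof, p. 73)] [cite: SerreLocalFields1979, Ch. X §3 and Ch. XIV §4] -/
theorem exists_finset_cocycle_reps_of_cyclotomicLine_subgroup :
    ∃ S : Finset (contOneCocycles (discreteTopRep H A)),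
      S.card ≤ B * ((Finset.range (p ^ k)).filter fun c : ℕ ↦
          ∀ σ ∈ H, σ • (c • P₀) = c • P₀).card ∧
      ∀ ψ : contOneCocycles (discreteTopRep H A),
        (∀ g, ∃ c : ℕ, ψ.1 g = c • P₀) →
          ∃ ψ₀ ∈ S, ∃ t : A, p ^ k • t = 0 ∧ ∀ g : H, ψ.1 g - ψ₀.1 g = g • t - t := by
  -- basic facts about the layer
  set q : ℕ := Nat.card (IsLocalRing.ResidueField (v.adicCompletionIntegers K)) with hqdef
  have hpk : p ^ k ≠ 0 := pow_ne_zero k hp.out.ne_zero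
  have hζ0 : ζ ≠ 0 := hζ.ne_zero hpk
  have hm0 : q ^ f - 1 ≠ 0 := residueCard_pow_sub_one_ne_zero (v := v) hf
  have hmw : w ((q ^ f - 1 : ℕ) : AlgebraicClosure (v.adicCompletion K)) = 1 :=
    spectralValuation_natCast_residueCard_pow_sub_one hw hf
  have hζLpow : ζL ^ (q ^ f - 1) = 1 := hζL.pow_eq_one
  have hFrL : Fr • ζL = ζL ^ q := frobenius_smul_eq_pow_of_pow_eq_one hw h𝔐 hFr hm0 hmw hζLpow
  have hsmulH : ∀ (g : H) (y : A), g • y = (g : absoluteGaloisGroup (v.adicCompletion K)) • y :=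
    fun _ _ ↦ rfl
  have hcontH : ∀ y : A, Continuous fun g : H ↦ g • y := fun y ↦
    (hcont y).comp continuous_subtype_val
  set FrH : H := ⟨Fr, hFrH⟩ with hFrHdef
  -- the subgroup `N'' = N' ∩ H` of `H`
  let N'' : Subgroup H :=
    { carrier := {n | (n : absoluteGaloisGroup (v.adicCompletion K)) • ζL = ζL}
      one_mem' := one_smul _ ζL
      mul_mem' := fun {n n'} hn hn' ↦ by
        change ((n : absoluteGaloisGroup (v.adicCompletion K)) * n') • ζL = ζL
        rw [mul_smul, hn', hn]
      inv_mem' := fun {n} hn ↦ by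
        change (n : absoluteGaloisGroup (v.adicCompletion K))⁻¹ • ζL = ζL
        rw [inv_smul_eq_iff, hn] }
  have hN''mem : ∀ n : H, n ∈ N'' ↔ (n : absoluteGaloisGroup (v.adicCompletion K)) • ζL = ζL :=
    fun n ↦ Iff.rfl
  have hsmul_prim : ∀ σ : absoluteGaloisGroup (v.adicCompletion K), IsPrimitiveRoot (σ • ζL) (q ^ f - 1) :=
    fun σ ↦ by
      have hinj : Function.Injective (MulSemiringAction.toRingHom
          (absoluteGaloisGroup (v.adicCompletion K)) (AlgebraicClosure (v.adicCompletion K)) σ) :=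
        RingHom.injective _
      exact hζL.map_of_injective hinj
  haveI : NeZero (q ^ f - 1) := ⟨hm0⟩
  haveI hN''normal : N''.Normal := ⟨fun n hn σ ↦ by
    rw [hN''mem] at hn ⊢
    have hcoe : ((σ * n * σ⁻¹ : H) : absoluteGaloisGroup (v.adicCompletion K)) =
        (σ : absoluteGaloisGroup (v.adicCompletion K)) * n *
          (σ : absoluteGaloisGroup (v.adicCompletion K))⁻¹ := by
      rw [Subgroup.coe_mul, Subgroup.coe_mul, Subgroup.coe_inv]
    rw [hcoe]
    obtain ⟨i, -, hi⟩ := hζL.eq_pow_of_pow_eq_one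
      (hsmul_prim (σ : absoluteGaloisGroup (v.adicCompletion K))⁻¹).pow_eq_one
    rw [mul_smul, mul_smul, ← hi, smul_pow', hn, hi, smul_inv_smul]⟩
  -- `H` is topologically generated by `N' ∩ H` and `Fr`
  have hgenΓ : ∀ U : Subgroup (absoluteGaloisGroup (v.adicCompletion K)),
      IsOpen (U : Set (absoluteGaloisGroup (v.adicCompletion K))) →
        (∀ σ ∈ H, σ • ζL = ζL → σ ∈ U) → Fr ∈ U → H ≤ U := by
    intro U hU hNU hFrU σ hσ
    have hU' : IsOpen ((U ⊓ H : Subgroup (absoluteGaloisGroup (v.adicCompletion K))) :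
        Set (absoluteGaloisGroup (v.adicCompletion K))) := by
      rw [Subgroup.coe_inf]; exact hU.inter hHopen
    obtain ⟨m, τ, u, hτ, hu, rfl⟩ := exists_eq_frobenius_pow_mul_inertia_mul v h𝔐 hFr hU' σ
    have huU : u ∈ U := (Subgroup.mem_inf.mp hu).1
    have huH : u ∈ H := (Subgroup.mem_inf.mp hu).2
    have hτH : τ ∈ H := by
      have h : (Fr ^ m)⁻¹ * (Fr ^ m * τ * u) * u⁻¹ = τ := by group
      rw [← h]
      exact H.mul_mem (H.mul_mem (H.inv_mem (H.pow_mem hFrH m)) hσ) (H.inv_mem huH)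
    have hτζ : τ • ζL = ζL := smul_eq_self_of_mem_inertia_of_pow_eq_one hw h𝔐 hτ hm0 hmw hζLpow
    exact U.mul_mem (U.mul_mem (U.pow_mem hFrU m) (hNU τ hτH hτζ)) huU
  have hgen : ∀ U : Subgroup H, IsOpen (U : Set H) → N'' ≤ U → FrH ∈ U → U = ⊤ := by
    intro U hU hNU hFrU
    let U' : Subgroup (absoluteGaloisGroup (v.adicCompletion K)) := U.map H.subtype
    have hopen : IsOpen (U' : Set (absoluteGaloisGroup (v.adicCompletion K))) :=
      hHopen.isOpenMap_subtype_val _ hU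
    have hNU' : ∀ σ ∈ H, σ • ζL = ζL → σ ∈ U' := fun σ hσ hζ' ↦
      ⟨⟨σ, hσ⟩, hNU ((hN''mem _).mpr hζ'), rfl⟩
    have hFrU' : Fr ∈ U' := ⟨FrH, hFrU, rfl⟩
    have hle := hgenΓ U' hopen hNU' hFrU'
    rw [eq_top_iff]
    intro x _
    obtain ⟨u, hu, hux⟩ := hle x.2
    have : u = x := Subtype.ext hux
    exact this ▸ hu
  -- the layer count
  obtain ⟨R, hRcard, hR, hRcov⟩ := hR
  -- Kummer data of an admissible cocycle
  let KUM : contOneCocycles (discreteTopRep H A) → AlgebraicClosure (v.adicCompletion K) → Prop :=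
    fun ψ x ↦ ∀ n : H, (n : absoluteGaloisGroup (v.adicCompletion K)) • ζL = ζL →
      ∃ c : ℕ, ψ.1 n = c • P₀ ∧ (n : absoluteGaloisGroup (v.adicCompletion K)) • x = ζ ^ c * x
  let DATA : contOneCocycles (discreteTopRep H A) → AlgebraicClosure (v.adicCompletion K) → Prop :=
    fun ψ r ↦ ∃ x β : AlgebraicClosure (v.adicCompletion K), x ≠ 0 ∧ β ∈ L ∧ β ≠ 0 ∧
      x ^ p ^ k = r * β ^ p ^ k ∧ KUM ψ x
  have hdata : ∀ ψ : contOneCocycles (discreteTopRep H A),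
      (∀ g, ∃ c : ℕ, ψ.1 g = c • P₀) → ∃ r ∈ R, DATA ψ r := by
    intro ψ hψ
    obtain ⟨x, hx0, hkum, hαL, γ, hγL, hγ0, hγeq⟩ :=
      exists_kummer_generator_subgroup H hFrH ⟨q, hFrL⟩ L hL1 hL2 hL3 hP₀ hζ hN' ha hb he ψ hψ
    obtain ⟨r, hr, β, hβL, hβ0, hrβ⟩ := hRcov (x ^ p ^ k) hαL (pow_ne_zero _ hx0) ⟨γ, hγL, hγ0, hγeq⟩
    exact ⟨r, hr, x, β, hx0, hβL, hβ0, hrβ, hkum⟩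
  -- a base cocycle for each representative `r`
  let ψb : AlgebraicClosure (v.adicCompletion K) → contOneCocycles (discreteTopRep H A) := fun r ↦
    if h : ∃ ψ, (∀ g, ∃ c : ℕ, ψ.1 g = c • P₀) ∧ DATA ψ r then h.choose else 0
  have hψb : ∀ r, (∃ ψ : contOneCocycles (discreteTopRep H A),
      (∀ g, ∃ c : ℕ, ψ.1 g = c • P₀) ∧ DATA ψ r) →
      (∀ g, ∃ c : ℕ, (ψb r).1 g = c • P₀) ∧ DATA (ψb r) r := fun r h ↦ by
    simp only [ψb, dif_pos h]
    exact h.choose_spec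
  -- two cocycles with data for the same `r` differ on `N''` by `∂(s P₀)`
  have hpair : ∀ {ψ ψ' : contOneCocycles (discreteTopRep H A)}
      {r : AlgebraicClosure (v.adicCompletion K)}, DATA ψ r → DATA ψ' r →
      ∃ s : ℕ, ∀ n : H, (n : absoluteGaloisGroup (v.adicCompletion K)) • ζL = ζL →
        ψ.1 n - ψ'.1 n = n • (s • P₀) - s • P₀ := by
    rintro ψ ψ' r ⟨x, β, hx0, hβL, hβ0, hr, hx⟩ ⟨x', β', hx'0, hβ'L, hβ'0, hr', hx'⟩
    exact exists_sub_eq_coboundary_of_kummer_subgroup H L hL1 hP₀ hζ hN' ψ ψ' hx0 hx'0 hβL hβ0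
      hβ'L hβ'0 hr hr' hx hx'
  -- (Y) the `N''`-fixed multiples of `P₀`, `T = Fr - 1` on it, and coset representatives
  have hmult_sub : ∀ {y y' : A}, (∃ c : ℕ, y = c • P₀) → (∃ c : ℕ, y' = c • P₀) →
      ∃ c : ℕ, y - y' = c • P₀ := by
    rintro y y' ⟨c, rfl⟩ ⟨c', rfl⟩
    obtain ⟨d, hd⟩ := exists_nsmul_eq_sub hP₀ hpk c c'
    exact ⟨d, hd⟩
  let Y : AddSubgroup A :=
    { carrier := {y | (∃ c : ℕ, y = c • P₀) ∧
        ∀ n ∈ H, n • ζL = ζL → n • y = y}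
      zero_mem' := ⟨⟨0, (zero_smul ℕ P₀).symm⟩, fun n _ _ ↦ smul_zero n⟩
      add_mem' := by
        rintro y y' ⟨⟨c, rfl⟩, hy⟩ ⟨⟨c', rfl⟩, hy'⟩
        exact ⟨⟨c + c', (add_smul c c' P₀).symm⟩, fun n hnH hn ↦ by
          rw [smul_add, hy n hnH hn, hy' n hnH hn]⟩
      neg_mem' := by
        rintro y ⟨hyc, hy⟩
        obtain ⟨d, hd⟩ := hmult_sub ⟨0, (zero_smul ℕ P₀).symm⟩ hyc
        rw [zero_sub] at hd
        exact ⟨⟨d, hd⟩, fun n hnH hn ↦ by rw [smul_neg, hy n hnH hn]⟩ }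
  have hYmem : ∀ y : A, y ∈ Y ↔ (∃ c : ℕ, y = c • P₀) ∧
      ∀ n ∈ H, n • ζL = ζL → n • y = y := fun y ↦ Iff.rfl
  -- every multiple of `P₀` is `c • P₀` with `c < p^k`
  have hreduce : ∀ c : ℕ, ∃ c' < p ^ k, c • P₀ = c' • P₀ := fun c ↦ by
    refine ⟨c % p ^ k, Nat.mod_lt c (Nat.pos_of_ne_zero hpk), ?_⟩
    rw [nsmul_eq_nsmul_iff_dvd_sub hP₀]
    exact Nat.modEq_iff_dvd.mp (Nat.mod_modEq c (p ^ k))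
  haveI : Finite Y := by
    have hfin : Set.Finite (((Finset.range (p ^ k)).image fun c : ℕ ↦ c • P₀ : Finset A) : Set A) :=
      Finset.finite_toSet _
    refine Set.Finite.to_subtype (hfin.subset ?_)
    rintro y ⟨⟨c, rfl⟩, -⟩
    obtain ⟨c', hc', hcc'⟩ := hreduce c
    simp only [Finset.coe_image, Finset.coe_range, Set.mem_image, Set.mem_Iio]
    exact ⟨c', hc', hcc'.symm⟩
  -- `Fr` acts on `Y`
  have hFrY : ∀ y ∈ Y, Fr • y ∈ Y := by
    rintro y ⟨⟨c, rfl⟩, hy⟩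
    refine ⟨⟨c * b, by rw [smul_comm Fr c P₀, hb, ← mul_smul]⟩, fun n hnH hn ↦ ?_⟩
    have hn'H : Fr⁻¹ * n * Fr ∈ H := H.mul_mem (H.mul_mem (H.inv_mem hFrH) hnH) hFrH
    have hn' : (Fr⁻¹ * n * Fr) • ζL = ζL := by
      have h := hN''normal.conj_mem' ⟨n, hnH⟩ ((hN''mem _).mpr hn) FrH
      exact h
    rw [← mul_smul, show n * Fr = Fr * (Fr⁻¹ * n * Fr) by group, mul_smul, hy _ hn'H hn']
  let FrY : Y →+ Y :=
    { toFun := fun y ↦ ⟨Fr • (y : A), hFrY y y.2⟩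
      map_zero' := Subtype.ext (smul_zero Fr)
      map_add' := fun y y' ↦ Subtype.ext (smul_add Fr (y : A) y') }
  let T : Y →+ Y := FrY - AddMonoidHom.id Y
  have hT : ∀ y : Y, ((T y : Y) : A) = Fr • (y : A) - y := fun y ↦ rfl
  obtain ⟨Rep, hRepcard, hRep⟩ := exists_finset_rep_of_map_mem T T.range fun y _ ↦ ⟨y, rfl⟩
  have hRep' : ∀ y : Y, ∃ ρ ∈ Rep, y - ρ ∈ T.range := fun y ↦ hRep y ⟨y, rfl⟩
  -- `#ker T ≤ M₀`: an element of `Y` fixed by `Fr` is fixed by all of `H`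
  have hkerfix : ∀ y : Y, T y = 0 → ∀ σ ∈ H, σ • (y : A) = y := by
    intro y hy σ hσ
    have hFry : Fr • (y : A) = y := by
      have := congrArg (fun z : Y ↦ (z : A)) hy
      simp only [hT, ZeroMemClass.coe_zero, sub_eq_zero] at this
      exact this
    let U : Subgroup (absoluteGaloisGroup (v.adicCompletion K)) := MulAction.stabilizer _ (y : A)
    have hU : IsOpen (U : Set (absoluteGaloisGroup (v.adicCompletion K))) :=
      (isOpen_discrete ({(y : A)} : Set A)).preimage (hcont (y : A))
    have hle := hgenΓ U hU (fun n hnH hn ↦ y.2.2 n hnH hn) hFry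
    exact hle hσ
  have hkercard : Nat.card T.ker ≤ ((Finset.range (p ^ k)).filter fun c : ℕ ↦
      ∀ σ ∈ H, σ • (c • P₀) = c • P₀).card := by
    -- `y ↦ c` with `y = c • P₀`, `c < p^k`
    have hch : ∀ y : T.ker, ∃ c : ℕ, c < p ^ k ∧ ((y : Y) : A) = c • P₀ := fun y ↦ by
      obtain ⟨c, hc⟩ := (y : Y).2.1
      obtain ⟨c', hc', hcc'⟩ := hreduce c
      exact ⟨c', hc', hc.trans hcc'⟩
    choose cf hcf hcfeq using hch
    let ι : T.ker → ((Finset.range (p ^ k)).filter fun c : ℕ ↦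
        ∀ σ ∈ H, σ • (c • P₀) = c • P₀) := fun y ↦
      ⟨cf y, by
        rw [Finset.mem_filter, Finset.mem_range]
        refine ⟨hcf y, fun σ hσ ↦ ?_⟩
        rw [← hcfeq y]
        exact hkerfix (y : Y) y.2 σ hσ⟩
    have hι : Function.Injective ι := by
      intro y y' h
      have hc : cf y = cf y' := congrArg Subtype.val h
      apply Subtype.ext; apply Subtype.ext
      rw [hcfeq y, hcfeq y', hc]
    calc Nat.card T.ker ≤ Nat.card _ := Nat.card_le_card_of_injective ι hι
      _ = _ := Nat.card_eq_finsetCard _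
  -- (labels) `LABEL ψ (r, ρ)`
  let ADM : contOneCocycles (discreteTopRep H A) → Prop := fun ψ ↦ ∀ g, ∃ c : ℕ, ψ.1 g = c • P₀
  let LABEL : contOneCocycles (discreteTopRep H A) →
      AlgebraicClosure (v.adicCompletion K) × Y → Prop := fun ψ q' ↦
    DATA ψ q'.1 ∧ ∃ s : ℕ,
      (∀ n : H, (n : absoluteGaloisGroup (v.adicCompletion K)) • ζL = ζL →
        ψ.1 n - (ψb q'.1).1 n = n • (s • P₀) - s • P₀) ∧
      ∃ hv : (ψ - ψb q'.1 - cobCocycle (s • P₀) (hcontH _)).1 FrH ∈ Y,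
        (⟨_, hv⟩ : Y) - q'.2 ∈ T.range
  -- values of `θ = ψ - ψb r - ∂(s P₀)`
  have hθval : ∀ (ψ : contOneCocycles (discreteTopRep H A))
      (r : AlgebraicClosure (v.adicCompletion K)) (s : ℕ) (g : H),
      (ψ - ψb r - cobCocycle (s • P₀) (hcontH _)).1 g = ψ.1 g - (ψb r).1 g - (g • (s • P₀) - s • P₀) :=
    fun ψ r s g ↦ by rw [Submodule.coe_sub, Submodule.coe_sub, ContinuousMap.sub_apply,
      ContinuousMap.sub_apply, cobCocycle_apply]
  -- (L1) every admissible cocycle has a label in `R × Rep`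
  have hL1' : ∀ ψ, ADM ψ → ∃ r ∈ R, ∃ ρ ∈ Rep, LABEL ψ (r, ρ) := by
    intro ψ hψ
    obtain ⟨r, hr, hD⟩ := hdata ψ hψ
    obtain ⟨hbadm, hbD⟩ := hψb r ⟨ψ, hψ, hD⟩
    obtain ⟨s, hs⟩ := hpair hD hbD
    set θ := ψ - ψb r - cobCocycle (s • P₀) (hcontH _) with hθdef
    have hθN : ∀ n ∈ N'', θ.1 n = 0 := fun n hn ↦ by
      rw [hθdef, hθval, hs n ((hN''mem n).mp hn), sub_self]
    have hvY : θ.1 FrH ∈ Y := by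
      refine ⟨?_, fun n hnH hn ↦ ?_⟩
      · rw [hθdef, hθval]
        obtain ⟨c₁, hc₁⟩ := hψ FrH
        obtain ⟨c₂, hc₂⟩ := hbadm FrH
        rw [hc₁, hc₂, hsmulH, smul_comm Fr s P₀, hb, ← mul_smul]
        obtain ⟨d₁, hd₁⟩ := hmult_sub ⟨c₁, rfl⟩ ⟨c₂, rfl⟩
        obtain ⟨d₂, hd₂⟩ := hmult_sub ⟨s * b, rfl⟩ ⟨s, rfl⟩
        rw [hd₁, hd₂]
        exact hmult_sub ⟨d₁, rfl⟩ ⟨d₂, rfl⟩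
      · exact apply_mem_fixedPoints N'' A θ hθN FrH ⟨⟨n, hnH⟩, (hN''mem _).mpr hn⟩
    obtain ⟨ρ, hρ, hvρ⟩ := hRep' ⟨θ.1 FrH, hvY⟩
    exact ⟨r, hr, ρ, hρ, hD, s, hs, hvY, hvρ⟩
  -- (L2) two cocycles with the same label differ by the coboundary of a torsion element
  have hL2' : ∀ {ψ ψ' : contOneCocycles (discreteTopRep H A)}
      {q' : AlgebraicClosure (v.adicCompletion K) × Y}, LABEL ψ q' → LABEL ψ' q' →
      ∃ t : A, p ^ k • t = 0 ∧ ∀ g : H, ψ.1 g - ψ'.1 g = g • t - t := by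
    rintro ψ ψ' ⟨r, ρ⟩ ⟨-, s, hs, hv, hvρ⟩ ⟨-, s', hs', hv', hv'ρ⟩
    obtain ⟨y₁, hy₁⟩ := hvρ
    obtain ⟨y₂, hy₂⟩ := hv'ρ
    set θ := ψ - ψb r - cobCocycle (s • P₀) (hcontH _) with hθdef
    set θ' := ψ' - ψb r - cobCocycle (s' • P₀) (hcontH _) with hθ'def
    set y₀ : A := (y₁ : A) - (y₂ : A) with hy₀def
    -- the values at `Fr`
    have hFr0 : θ.1 FrH - θ'.1 FrH = Fr • y₀ - y₀ := by
      have h1 := congrArg (fun z : Y ↦ (z : A)) hy₁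
      have h2 := congrArg (fun z : Y ↦ (z : A)) hy₂
      simp only [hT, AddSubgroup.coe_sub] at h1 h2
      change Fr • (y₁ : A) - y₁ = θ.1 FrH - ρ at h1
      change Fr • (y₂ : A) - y₂ = θ'.1 FrH - ρ at h2
      rw [hy₀def, smul_sub, show Fr • (y₁ : A) - Fr • (y₂ : A) - ((y₁ : A) - (y₂ : A)) =
        (Fr • (y₁ : A) - y₁) - (Fr • (y₂ : A) - y₂) by abel, h1, h2]
      abel
    -- `Θ = θ - θ' - ∂y₀` vanishes on `N''` and at `Fr`, hence everywhere
    have hy₀fix : ∀ n ∈ N'', n • y₀ = y₀ := fun n hn ↦ by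
      rw [hy₀def, smul_sub, hsmulH, hsmulH, y₁.2.2 n n.2 ((hN''mem n).mp hn),
        y₂.2.2 n n.2 ((hN''mem n).mp hn)]
    set Θ := θ - θ' - cobCocycle y₀ (hcontH y₀) with hΘdef
    have hΘval : ∀ g : H, Θ.1 g = θ.1 g - θ'.1 g - (g • y₀ - y₀) := fun g ↦ by
      rw [hΘdef, Submodule.coe_sub, Submodule.coe_sub, ContinuousMap.sub_apply,
        ContinuousMap.sub_apply, cobCocycle_apply]
    have hΘN : ∀ n ∈ N'', Θ.1 n = 0 := fun n hn ↦ by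
      rw [hΘval, hθdef, hθ'def, hθval, hθval, hs n ((hN''mem n).mp hn),
        hs' n ((hN''mem n).mp hn), hy₀fix n hn]
      simp
    have hΘFr : Θ.1 FrH = 0 := by
      rw [hΘval, hFr0, hsmulH, sub_self]
    have hΘ0 : Θ = 0 := eq_zero_of_apply_eq_zero N'' FrH hgen Θ hΘN hΘFr
    -- the torsion element
    refine ⟨s • P₀ - s' • P₀ + y₀, ?_, fun g ↦ ?_⟩
    · obtain ⟨c₀, hc₀⟩ := hmult_sub y₁.2.1 y₂.2.1
      have hpP : p ^ k • P₀ = 0 := (nsmul_eq_zero_iff_dvd hP₀ (p ^ k)).mpr (dvd_refl _)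
      rw [← hy₀def] at hc₀
      rw [smul_add, smul_sub, hc₀, smul_comm (p ^ k) s P₀, smul_comm (p ^ k) s' P₀,
        smul_comm (p ^ k) c₀ P₀, hpP, smul_zero, smul_zero, smul_zero, sub_self, zero_add]
    · have h := hΘval g
      rw [hΘ0] at h
      change (0 : A) = _ at h
      rw [hθdef, hθ'def, hθval, hθval] at h
      rw [smul_add, smul_sub]
      have key : ψ.1 g - ψ'.1 g - (g • (s • P₀) - g • (s' • P₀) + g • y₀ - (s • P₀ - s' • P₀ + y₀)) =
          ψ.1 g - (ψb r).1 g - (g • (s • P₀) - s • P₀) -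
            (ψ'.1 g - (ψb r).1 g - (g • (s' • P₀) - s' • P₀)) - (g • y₀ - y₀) := by abel
      rw [← sub_eq_zero, key]
      exact h.symm
  -- the set of representatives
  let G : AlgebraicClosure (v.adicCompletion K) × Y → contOneCocycles (discreteTopRep H A) :=
    fun q' ↦ if h : ∃ ψ, ADM ψ ∧ LABEL ψ q' then h.choose else 0
  have hG : ∀ q', (∃ ψ, ADM ψ ∧ LABEL ψ q') → LABEL (G q') q' := fun q' h ↦ by
    simp only [G, dif_pos h]; exact h.choose_spec.2
  refine ⟨(R ×ˢ Rep).image G, ?_, fun ψ hψ ↦ ?_⟩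
  · refine Finset.card_image_le.trans ?_
    rw [Finset.card_product]
    exact Nat.mul_le_mul hRcard (hRepcard.trans hkercard)
  · obtain ⟨r, hr, ρ, hρ, hlab⟩ := hL1' ψ hψ
    have hlab' : LABEL (G (r, ρ)) (r, ρ) := hG (r, ρ) ⟨ψ, hψ, hlab⟩
    obtain ⟨t, ht, hdiff⟩ := hL2' hlab hlab'
    exact ⟨G (r, ρ), Finset.mem_image.mpr ⟨(r, ρ), Finset.mem_product.mpr ⟨hr, hρ⟩, rfl⟩, t, ht, hdiff⟩

end Count

end IsDedekindDomain.HeightOneSpectrum
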